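import Literature.Barriers.NavierStokesRegularity.AveragedTypeIBlowup
import HarnessLib

/-!
# Barrier: the averaged-equation STEP TEST for two-step regularity arguments («a priori bound ⊕ continuation criterion»)

Barrier catalogue entry for `NavierStokesRegularity` (D-0021), written for the claims sweep of
cell `ns-claims` (D-0090: «where claimed Navier–Stokes regularity proofs break»). It adds no new
analysis: it is VOCABULARY over T. Tao's class of averaged Navier–Stokes equations (the accepted
`Literature.Analysis.FluidPDE.Tao2016.AveragingDatum` with `IsSymmetric`, `HasCancellation`,
`IsMildSolution`, `GlobalRegularity`) plus the one-line consequences of the two refuting facts the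
tree already holds —

* `Literature.Analysis.FluidPDE.Tao2016.exists_not_globalRegularity` (Tao 2016, Thm. 1.5: some
  symmetric averaged Euler bilinear operator `B̃` with the cancellation property has a Schwartz
  divergence-free datum without global `H¹⁰_df`-mild solution; PROVED in the tree,
  `exists_not_globalRegularity_holds`, `TaoAveragedCascadeHolds.lean`; catalogue entry
  `TaoAveragedBlowup`), and
* `Literature.Barriers.NavierStokesRegularity.AveragedTypeIBlowup` (this tree, 2026: a symmetric
  cancelling `B̃`, a Schwartz datum and an `H¹⁰_df`-mild solution on `[0,T)` at the Type-I rate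
  with NO mild extension past `T`; PROVED Summits-side, `AveragedTypeIBlowup_holds` in
  `Summits/NavierStokesRegularity/NavierStokesRegularity/Theorems/PerpetualPumpAveragedTypeIBlowupHolds.lean`;
  in this directory a named fact, so every consequence below takes `(h : AveragedTypeIBlowup)`)

— arranged as a TEST that a typed step of a claimed regularity proof either passes or fails.

## The two-step template

Claimed proofs of global regularity in the harmonic-analysis family (technique classes T1/T12 of
the cell's MAP-SCHEMA: energy/enstrophy or frequency-localised energy estimates, Littlewood–Paley
and paraproduct bounds, interpolation chains, rescaling) have, once typed, the shape

  (A) an A PRIORI BOUND: some functional `N` of the time slice stays bounded along every solution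
      up to its existence horizon (`APrioriBound N`), and
  (C) a CONTINUATION CRITERION: a solution on `[0,T)` along which `N` stays bounded extends past
      `T` (`ContinuesUnder N`),

composed as (A) ∧ (C) ⇒ no finite-time breakdown (`StepTest.noBreakdown_of_aprioriBound_of_continuesUnder`).
Genuine theorems of type (C) for the Navier–Stokes equations: `N = ‖·‖_{L³}` (Escauriaza–Seregin–
Šverák 2003, Thms. 1.3–1.4; Seregin 2012, Thm. 1.1: at a blow-up time `‖u(t)‖₃ → ∞`), `N` a critical
Besov norm (Gallagher–Koch–Planchon 2016), `N = ‖·‖_{Ḣ^{1/2}}` (Kenig–Koch 2011), and the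
Beale–Kato–Majda criterion `∫₀ᵀ ‖ω‖_∞ < ∞` (1984; a time-integrated variant). The OPEN content of
the regularity problem is then entirely in (A) for a critical or subcritical `N` — "for
Navier–Stokes we only have two really useful globally controlled quantities", the supercritical
energy and dissipation (catalogue entry `EnergySupercriticality`).

## The test (what the kernel theorems say)

Call a step `S : AveragingDatum → Prop` AVERAGING-INSENSITIVE (`IsAveragingInsensitive S`) when
it holds for every symmetric averaging datum with cancellation — the extensional shadow, inside
Lean, of Tao's informal criterion "the argument uses only the energy identity `⟨B̃(u,u),u⟩ = 0` and
the harmonic-analysis estimates that every averaged `B̃` inherits from `B`" [Tao 2016, §1.1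
pp. 6–8]. Then:

1. `not_isAveragingInsensitive_of_imp_globalRegularity` — a step that implies global regularity of
   the averaged equation it is stated for is not averaging-insensitive (from
   `exists_not_globalRegularity`);
2. `not_isAveragingInsensitive_of_imp_noBreakdown`, `…_of_imp_excludesTypeI` — a step that implies
   "every local mild solution extends" (or merely Type-I exclusion) for the averaged equation it is
   stated for is not averaging-insensitive (from `AveragedTypeIBlowup`);
3. `abstractTwoStepFails` — THE STEP TEST (the entry's main declaration, from `(h : AveragedTypeIBlowup)`): for NO slice functional `N` are
   both halves (A) and (C) averaging-insensitive; one-sided forms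
   `not_isAveragingInsensitive_aprioriBound` / `…_continuesUnder`: if one half is
   averaging-insensitive the other is not;
4. `IsAveragingInsensitive.euler` — the blocked class contains the Navier–Stokes equations
   themselves (`AveragingDatum.euler`: `B̃ = B`), so an averaging-insensitive (A) ∧ (C) would in
   particular settle "no finite-time breakdown of `H¹⁰_df`-mild solutions from Schwartz data" for
   Navier–Stokes (`noBreakdown_euler_iff`), the no-blow-up form of Tao's Conjecture 1.2.

How the cell uses it (MAP-SCHEMA §4, «averaged-equation test»): the refuter types the decisive
step of a claim as an `S` over this vocabulary and exhibits `S 𝒜 → GlobalRegularity 𝒜` /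
`NoBreakdown 𝒜` / `ExcludesTypeI 𝒜` pointwise in `𝒜`; items 1–2 then say the step cannot have an
averaging-insensitive proof, so the printed argument — if it uses only shared structure — has a
gap, to be located on the page. Item 3 classifies: when the claim's (C) is one of the genuine
Navier–Stokes continuation theorems above (all proved in print by NS-SPECIFIC structure: backward
uniqueness for the `L³`/`Ḣ^{1/2}`/Besov criteria, vorticity transport for BKM — Tao's named
evasions), the test does not by itself convict (A); it convicts (A) exactly when (C) is itself
averaging-insensitive (e.g. continuation under a bounded HIGH Sobolev norm, which is local theory).

## References

* T. Tao, *Finite time blowup for an averaged three-dimensional Navier–Stokes equation*, J. Amer.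
  Math. Soc. 29 (2016), 601–674; arXiv:1402.0290, §1.1 (pp. 3–8), Thm. 1.5. [`Tao2016AveragedNS`]
* L. Escauriaza, G. Seregin, V. Šverák, Russ. Math. Surveys 58 (2003), 211–250, Thms. 1.3–1.4.
  [`EscauriazaSereginSverak2003`]
* G. Seregin, Comm. Math. Phys. 312 (2012), 833–845, Thm. 1.1. [`Seregin2012CMP`]
* C. E. Kenig, G. S. Koch, Ann. Inst. H. Poincaré Anal. Non Linéaire 28 (2011), 159–187. [`KenigKoch2011`]
* I. Gallagher, G. Koch, F. Planchon, Comm. Math. Phys. 343 (2016), 39–82, Thm. 1. [`GKP2016`]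
* J. T. Beale, T. Kato, A. Majda, Comm. Math. Phys. 94 (1984), 61–66. [`BealeKatoMajda1984`]
* G. Koch, N. Nadirashvili, G. Seregin, V. Šverák, Acta Math. 203 (2009), 83–105, §1.
  [`KochNadirashviliSereginSverak2009`]

WHAT THIS IS NOT: not a claim about NS regularity or blow-up; not a claim about any author beyond the typed locator.
-/

noncomputable section

namespace Literature.Barriers.NavierStokesRegularity

open _root_.MeasureTheory Set
open scoped ENNReal NNReal
open Literature.Analysis.FluidPDE Literature.Analysis.FluidPDE.Tao2016

/-! ## Vocabulary (predicates with explicit binders — not named facts) -/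

namespace StepTest

/-- **Averaging-insensitive step.** A statement `S 𝒜` about the averaged Navier–Stokes equation
driven by the datum `𝒜` is *averaging-insensitive* if it holds for EVERY symmetric averaging datum
with the cancellation property — Tao's class (1.12)–(1.16). This is the extensional shadow of "`S`
is proved by an argument treating the bilinear operator abstractly, using only the cancellation
`⟨B̃(u,u),u⟩ = 0` and the function-space estimates shared by all averaged Euler operators": such an
argument proves `S 𝒜` for all these `𝒜` at once. A predicate on `S`; asserts nothing.
[cite: Tao2016AveragedNS, §1.1 pp. 6–8] -/
def IsAveragingInsensitive (S : AveragingDatum → Prop) : Prop :=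
  ∀ 𝒜 : AveragingDatum, 𝒜.IsSymmetric → 𝒜.HasCancellation → S 𝒜

/-- **Step (A): a priori bound on the slice functional `N`.** For every Schwartz divergence-free
datum, every horizon `T > 0` and every `H¹⁰_df`-mild solution `u` of `∂ₜu = Δu + B̃_𝒜(u,u)` on
`[0,T)` (Tao (1.15)), `N(u(t))` is bounded on `[0,T)`. (`N : L²(ℝ³;ℂ³) → [0,∞]` is any functional
of the slice: an `L^p`, Sobolev or Besov norm, a vorticity supremum, ….) [cite: Tao2016AveragedNS, §1.1 (1.15)] -/
def APrioriBound (N : L2C → ℝ≥0∞) (𝒜 : AveragingDatum) : Prop :=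
  ∀ u₀ : SchwartzMap (EuclideanSpace ℝ (Fin 3)) (EuclideanSpace ℝ (Fin 3)),
    VectorCalculus.IsDivFree ⇑u₀ → ∀ T : ℝ, 0 < T → ∀ u : ℝ → L2C,
      𝒜.IsMildSolution (schwartzL2 u₀) (Set.Ico 0 T) u →
        ∃ C : ℝ≥0, ∀ t ∈ Set.Ico 0 T, N (u t) ≤ C

/-- **Step (C): continuation under bounded `N`.** Every `H¹⁰_df`-mild solution on `[0,T)` from a
Schwartz divergence-free datum along which `N` stays bounded extends as a mild solution past `T`
(`AveragedTypeI.HasMildExtension`). For the Navier–Stokes equations and `N = ‖·‖_{L³}` this is the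
Escauriaza–Seregin–Šverák / Seregin continuation theorem; for `N = ‖·‖_{Ḣ^{1/2}}` Kenig–Koch; for
critical Besov norms Gallagher–Koch–Planchon. [cite: EscauriazaSereginSverak2003, Thms. 1.3–1.4]
[cite: Seregin2012CMP, Thm. 1.1] -/
def ContinuesUnder (N : L2C → ℝ≥0∞) (𝒜 : AveragingDatum) : Prop :=
  ∀ u₀ : SchwartzMap (EuclideanSpace ℝ (Fin 3)) (EuclideanSpace ℝ (Fin 3)),
    VectorCalculus.IsDivFree ⇑u₀ → ∀ T : ℝ, 0 < T → ∀ u : ℝ → L2C,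
      𝒜.IsMildSolution (schwartzL2 u₀) (Set.Ico 0 T) u →
        (∃ C : ℝ≥0, ∀ t ∈ Set.Ico 0 T, N (u t) ≤ C) →
          AveragedTypeI.HasMildExtension 𝒜 (schwartzL2 u₀) T u

/-- **No finite-time breakdown** for the averaged equation driven by `𝒜`: every `H¹⁰_df`-mild
solution on a finite horizon `[0,T)` from a Schwartz divergence-free datum extends as a mild
solution past `T`. (The no-blow-up form of global regularity; with Tao's `H¹⁰` local theory,
p. 7, it says that the `H¹⁰_df` norm of no local solution diverges in finite time.)
[cite: Tao2016AveragedNS, §1.1 p. 7 and Thm. 1.5] -/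
def NoBreakdown (𝒜 : AveragingDatum) : Prop :=
  ∀ u₀ : SchwartzMap (EuclideanSpace ℝ (Fin 3)) (EuclideanSpace ℝ (Fin 3)),
    VectorCalculus.IsDivFree ⇑u₀ → ∀ T : ℝ, 0 < T → ∀ u : ℝ → L2C,
      𝒜.IsMildSolution (schwartzL2 u₀) (Set.Ico 0 T) u →
        AveragedTypeI.HasMildExtension 𝒜 (schwartzL2 u₀) T u

/-! ## Composition and monotonicity (the template is a valid inference) -/

/-- **The two-step template composes**: an a priori bound on `N` together with continuation under
bounded `N` gives no finite-time breakdown — the inference pattern of every continuation criterion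
("the solution can be continued … provided the controlling quantity stays bounded", Beale–Kato–Majda
for `∫‖ω‖_∞`; Seregin for `‖u(t)‖_{L³}`). [cite: BealeKatoMajda1984, main theorem (continuation criterion)]
[cite: Seregin2012CMP, Thm. 1.1] -/
theorem noBreakdown_of_aprioriBound_of_continuesUnder {N : L2C → ℝ≥0∞} {𝒜 : AveragingDatum}
    (hA : APrioriBound N 𝒜) (hC : ContinuesUnder N 𝒜) : NoBreakdown 𝒜 :=
  fun u₀ hdiv T hT u hmild => hC u₀ hdiv T hT u hmild (hA u₀ hdiv T hT u hmild)

/-- No breakdown implies Type-I exclusion (`AveragedTypeI.ExcludesTypeI`: extension of solutions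
at the Type-I rate `‖u(t)‖_∞ ≤ M(T-t)^{-1/2}`) — the rate hypothesis is simply dropped; Type-I
exclusion is the special case of "no blow-up" singled out by Koch–Nadirashvili–Seregin–Šverák.
[cite: KochNadirashviliSereginSverak2009, §1 (definition of type I / type II)] -/
theorem NoBreakdown.excludesTypeI {𝒜 : AveragingDatum} (h : NoBreakdown 𝒜) :
    AveragedTypeI.ExcludesTypeI 𝒜 :=
  fun u₀ hdiv T hT u hmild _ => h u₀ hdiv T hT u hmild

/-! ## The blocked class contains the Navier–Stokes equations -/

/-- An averaging-insensitive step holds in particular for the Euler datum `mᵢ ≡ 1`, `Rᵢ = id`,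
`λᵢ = 1`, whose averaged form IS the Euler bilinear form `B` (`AveragingDatum.euler_form`): the
datum is symmetric with cancellation (Tao's (1.2)). [cite: Tao2016AveragedNS, §1.1 (1.2) and (1.13)] -/
theorem IsAveragingInsensitive.euler {S : AveragingDatum → Prop} (h : IsAveragingInsensitive S) :
    S AveragingDatum.euler :=
  h _ AveragingDatum.euler_isSymmetric AveragingDatum.euler_hasCancellation

/-- `NoBreakdown euler` spelled out: every `H¹⁰_df`-mild solution of the projected Navier–Stokes
equation `∂ₜu = Δu + B(u,u)` (`ν = 1`, Tao (1.5)/(1.6)) on `[0,T)` from a Schwartz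
divergence-free datum extends as a mild solution past `T` — the no-blow-up half of Tao's
Conjecture 1.2, an open statement. [cite: Tao2016AveragedNS, §1.1 Conj. 1.2 and (1.5)] -/
theorem noBreakdown_euler_iff :
    NoBreakdown AveragingDatum.euler ↔
      ∀ u₀ : SchwartzMap (EuclideanSpace ℝ (Fin 3)) (EuclideanSpace ℝ (Fin 3)),
        VectorCalculus.IsDivFree ⇑u₀ → ∀ T : ℝ, 0 < T → ∀ u : ℝ → L2C,
          IsMildSolutionFor eulerForm (schwartzL2 u₀) (Set.Ico 0 T) u →
            ∃ T' : ℝ, T < T' ∧ ∃ v : ℝ → L2C,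
              IsMildSolutionFor eulerForm (schwartzL2 u₀) (Set.Ico 0 T') v ∧
                ∀ t ∈ Set.Ico 0 T, v t = u t := by
  simp only [NoBreakdown, AveragedTypeI.HasMildExtension, AveragedTypeI.isMildSolution_euler_iff]

/-! ## The refuter's interface: three refuted conclusions -/

/-- **Test 1 (global regularity).** A step `S` which, for each symmetric cancelling datum, implies
global regularity of the averaged equation it speaks about (`Tao2016.GlobalRegularity 𝒜`: every
Schwartz divergence-free datum has a global `H¹⁰_df`-mild solution) is NOT averaging-insensitive —
given Tao's Theorem 1.5 in the form `exists_not_globalRegularity` (PROVED in the tree: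
`Tao2016.exists_not_globalRegularity_holds`). [cite: Tao2016AveragedNS, §1.1 Thm. 1.5 and p. 8] -/
theorem not_isAveragingInsensitive_of_imp_globalRegularity (h : exists_not_globalRegularity)
    {S : AveragingDatum → Prop}
    (hS : ∀ 𝒜 : AveragingDatum, 𝒜.IsSymmetric → 𝒜.HasCancellation → S 𝒜 → GlobalRegularity 𝒜) :
    ¬ IsAveragingInsensitive S := by
  obtain ⟨𝒜, hs, hc, hno⟩ := h
  exact fun hall => hno (hS 𝒜 hs hc (hall 𝒜 hs hc))

/-- In particular global regularity itself is not averaging-insensitive (Tao's formulation: any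
proof of Conjecture 1.2 "must use finer structure"). [cite: Tao2016AveragedNS, §1.1 p. 5 and Thm. 1.5] -/
theorem not_isAveragingInsensitive_globalRegularity (h : exists_not_globalRegularity) :
    ¬ IsAveragingInsensitive GlobalRegularity :=
  not_isAveragingInsensitive_of_imp_globalRegularity h fun _ _ _ h𝒜 => h𝒜

/-- **Test 2 (Type-I exclusion).** A step `S` which, for each symmetric cancelling datum, implies
Type-I exclusion for the averaged equation it speaks about is NOT averaging-insensitive — given
the entry `AveragedTypeIBlowup` (`AveragedTypeIBlowup.not_forall_excludesTypeI`).
[cite: Tao2016AveragedNS, §1.1 p. 8 and footnote] -/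
theorem not_isAveragingInsensitive_of_imp_excludesTypeI (h : AveragedTypeIBlowup)
    {S : AveragingDatum → Prop}
    (hS : ∀ 𝒜 : AveragingDatum, 𝒜.IsSymmetric → 𝒜.HasCancellation → S 𝒜 →
      AveragedTypeI.ExcludesTypeI 𝒜) :
    ¬ IsAveragingInsensitive S :=
  fun hall => h.not_forall_excludesTypeI fun 𝒜 hs hc => hS 𝒜 hs hc (hall 𝒜 hs hc)

/-- **Test 2' (no breakdown).** A step `S` which, for each symmetric cancelling datum, implies
that every local mild solution of the averaged equation extends (`NoBreakdown 𝒜`) is NOT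
averaging-insensitive — given `AveragedTypeIBlowup`. [cite: Tao2016AveragedNS, §1.1 Thm. 1.5 and p. 8] -/
theorem not_isAveragingInsensitive_of_imp_noBreakdown (h : AveragedTypeIBlowup)
    {S : AveragingDatum → Prop}
    (hS : ∀ 𝒜 : AveragingDatum, 𝒜.IsSymmetric → 𝒜.HasCancellation → S 𝒜 → NoBreakdown 𝒜) :
    ¬ IsAveragingInsensitive S :=
  not_isAveragingInsensitive_of_imp_excludesTypeI h fun 𝒜 hs hc h𝒜 => (hS 𝒜 hs hc h𝒜).excludesTypeI

/-- No breakdown itself is not averaging-insensitive: some symmetric cancelling averaged equation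
has a local mild solution from Schwartz data that does not extend. [cite: Tao2016AveragedNS, §1.1 Thm. 1.5 and p. 8] -/
theorem not_isAveragingInsensitive_noBreakdown (h : AveragedTypeIBlowup) :
    ¬ IsAveragingInsensitive NoBreakdown :=
  not_isAveragingInsensitive_of_imp_noBreakdown h fun _ _ _ h𝒜 => h𝒜

end StepTest

open StepTest

/-! ## The entry -/

/-- **Barrier (averaged-equation step test for the two-step template): no slice functional admits
an averaging-insensitive «a priori bound ⊕ continuation» pair.** Given the entry
`AveragedTypeIBlowup`, for every functional `N : L²(ℝ³;ℂ³) → [0,∞]` of the time slice it is NOT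
the case that both (A) "`N(u(t))` stays bounded along every `H¹⁰_df`-mild solution from Schwartz
divergence-free data up to its horizon" (`StepTest.APrioriBound N 𝒜`) and (C) "a mild solution on
`[0,T)` with `N` bounded extends past `T`" (`StepTest.ContinuesUnder N 𝒜`) hold for every
symmetric averaging datum `𝒜` with cancellation in Tao's class (1.12)–(1.16): an
averaging-insensitive pair would make every local mild solution of every such averaged equation
extend (`noBreakdown_of_aprioriBound_of_continuesUnder`), against the non-extendable solution of
the entry. This is the MAIN DECLARATION of the catalogue entry; it is stated as a theorem from
`(h : AveragedTypeIBlowup)` (that entry is proved Summits-side, `AveragedTypeIBlowup_holds`; this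
directory does not import Summits) rather than as a closed `Prop`, so that it adds no named fact.
Not a printed theorem — Tao prints the Type-II Theorem 1.5 and the dictum that strategies which
fail "to distinguish between the Euler bilinear operator `B` and its averaged counterparts `B̃`"
are "doomed to failure"; this is its kernel form for the (A) ⊕ (C) template.
[cite: Tao2016AveragedNS, §1.1 Thm. 1.5 (p. 7) and pp. 6–8]

BARRIER (structured block, D-0021):
- technique_class: energy-identity harmonic-analysis littlewood-paley paraproduct frequency-localised-energy interpolation-chain sobolev-besov-bookkeeping rescaling a-priori-estimate continuation-criterion blowup-criterion two-step-template abstract-bilinear-estimates — the cell `ns-claims` classes T1 (energy/enstrophy a priori estimate upgraded to a global strong bound) and T12 (function-space embedding / interpolation chains claimed to close at the critical level) [cite: Tao2016AveragedNS, §1.1 pp. 3–8]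
- blocks: for NavierStokesRegularity (regularity side), every claimed proof of the shape «(A) a priori bound on a slice functional `N` along all solutions ∧ (C) continuation under bounded `N` ⇒ no blow-up» in which BOTH steps are established by averaging-insensitive means (cancellation `⟨B̃(u,u),u⟩ = 0` + estimates shared by all averaged Euler operators `B̃`): formally `∀ N, ¬ IsAveragingInsensitive (fun 𝒜 => APrioriBound N 𝒜 ∧ ContinuesUnder N 𝒜)`; one-sidedly, if (C) is averaging-insensitive for `N` then no averaging-insensitive argument yields (A) for `N` (`not_isAveragingInsensitive_aprioriBound`), and symmetrically (`not_isAveragingInsensitive_continuesUnder`); more generally any typed step `S` with `S 𝒜 → GlobalRegularity 𝒜`, `S 𝒜 → NoBreakdown 𝒜` or `S 𝒜 → ExcludesTypeI 𝒜` pointwise in `𝒜` is not averaging-insensitive (`StepTest.not_isAveragingInsensitive_of_imp_globalRegularity` / `…_noBreakdown` / `…_excludesTypeI`) [cite: Tao2016AveragedNS, §1.1 pp. 5–8 and Thm. 1.5]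
- because: the entry `AveragedTypeIBlowup` supplies a symmetric cancelling datum `𝒜`, a Schwartz divergence-free `u₀` and an `H¹⁰_df`-mild solution on `[0,T)` with no mild extension past `T` (this tree's Type-I sharpening of Thm. 1.5, proved Summits-side along Tao's §§3–4: local cascade operators are averaged Euler operators, Thm. 3.2, and a non-extendable cascade solution) [cite: Tao2016AveragedNS, §3 Thm. 3.2 (p. 14) and §4 Lemma 4.1 (p. 21)]; if (A) and (C) both held for this `𝒜` the solution would extend — contradiction; Test 1 uses instead Thm. 1.5 itself in the form `exists_not_globalRegularity` (proved in the tree, `Tao2016.exists_not_globalRegularity_holds`) [cite: Tao2016AveragedNS, §1.1 Thm. 1.5]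
- evasions_known: a step (C) that is a genuine Navier–Stokes theorem proved by NS-specific structure passes the test and leaves (A) untested by it: continuation under a bounded `L³` / `L^{3,∞}` norm via backward uniqueness and unique continuation for backward heat operators, which "relies on being able to control the nonlinearity pointwise in terms of the solution and its first derivatives … in vorticity formulation" [cite: EscauriazaSereginSverak2003, Thms. 1.3–1.4] [cite: Seregin2012CMP, Thm. 1.1] [cite: Tao2016AveragedNS, §1.1 p. 8]; continuation under a bounded `Ḣ^{1/2}` norm by concentration-compactness plus rigidity [cite: KenigKoch2011, §1]; under a bounded critical Besov norm [cite: GKP2016, Thm. 1]; the Beale–Kato–Majda criterion through the vorticity transport equation [cite: BealeKatoMajda1984, main theorem (continuation criterion)]; Liouville theorems for bounded ancient solutions via scalar maximum principles (2-D, axisymmetric without swirl) [cite: KochNadirashviliSereginSverak2009, §1 and Thms. 5.1–5.2]; large data varying slowly in one direction, using algebraic properties of the symbol of `B` [cite: CheminGallagherPaicu2011, main theorem as reported by Tao 2016 §1.1 p. 8]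
- scope_caveats: (i) `IsAveragingInsensitive S` is the EXTENSIONAL shadow (truth of `S` for every symmetric cancelling datum) of an intensional notion (a proof using only shared structure); the inference "the printed argument for `S` uses only the energy identity and inherited estimates, hence would prove `S 𝒜` for all `𝒜`" is informal exactly as Tao's estimate-inheritance is ("we will not attempt to formalise this assertion here") and must be checked on the page, step by step; estimates in endpoint spaces `L¹`, `L^∞` are not inherited [cite: Tao2016AveragedNS, §1.1 pp. 6–7 and footnote p. 7]; (ii) the test is one-sided: when (C) is NS-specific (all the genuine continuation theorems listed under `evasions_known`), failure of the pair does not locate the failure in (A); the cell then needs the scaling audit (`EnergySupercriticality`) or a direct gap on the page [cite: Tao2016AveragedNS, §1.1 p. 5]; (iii) solutions are `H¹⁰_df`-mild from Schwartz data at `ν = 1` in Tao's duality formulation as rendered by `AveragingDatum` (`TaoAveragedBlowup` caveat (vi)); Leray–Hopf weak solutions, other data classes and the torus are not covered by the Lean statements [cite: Tao2016AveragedNS, §1.1 (1.13)–(1.15) and footnote p. 3]; (iv) Tests 2/2′ and this entry rest on `AveragedTypeIBlowup`, a theorem of this tree (Summits-side `AveragedTypeIBlowup_holds`), taken here as a hypothesis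 because Literature does not import Summits; Test 1 rests on Thm. 1.5, proved in the tree [cite: Tao2016AveragedNS, §1.1 Thm. 1.5 and footnote p. 8]; (v) nothing here is a claim about the Navier–Stokes equations: `NoBreakdown AveragingDatum.euler` (no finite-time breakdown of `H¹⁰_df`-mild Navier–Stokes solutions from Schwartz data, `noBreakdown_euler_iff`) is open [cite: Tao2016AveragedNS, §1.1 Conj. 1.2]
- status: established — a corollary of entries `TaoAveragedBlowup` (Thm. 1.5, proved in the tree) and `AveragedTypeIBlowup` (proved in the tree, Summits-side) -/
theorem abstractTwoStepFails (h : AveragedTypeIBlowup) (N : L2C → ℝ≥0∞) :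
    ¬ StepTest.IsAveragingInsensitive fun 𝒜 =>
        StepTest.APrioriBound N 𝒜 ∧ StepTest.ContinuesUnder N 𝒜 :=
  not_isAveragingInsensitive_of_imp_noBreakdown h
    fun _ _ _ h𝒜 => noBreakdown_of_aprioriBound_of_continuesUnder h𝒜.1 h𝒜.2

/-- **One-sided form, (C) given:** if continuation under bounded `N` holds for every symmetric
cancelling averaged equation (e.g. `N` controls the common local theory), then NO
averaging-insensitive argument bounds `N` a priori along all solutions. [cite: Tao2016AveragedNS, §1.1 pp. 6–8] -/
theorem not_isAveragingInsensitive_aprioriBound (h : AveragedTypeIBlowup) {N : L2C → ℝ≥0∞}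
    (hC : StepTest.IsAveragingInsensitive (StepTest.ContinuesUnder N)) :
    ¬ StepTest.IsAveragingInsensitive (StepTest.APrioriBound N) :=
  fun hA => abstractTwoStepFails h N fun 𝒜 hs hc =>
    ⟨hA 𝒜 hs hc, hC 𝒜 hs hc⟩

/-- **One-sided form, (A) given:** if an a priori bound on `N` holds for every symmetric cancelling
averaged equation (e.g. `N` is controlled by the energy: `‖·‖_{L²}`), then continuation under
bounded `N` is NOT averaging-insensitive — some symmetric cancelling averaged equation breaks down
with `N` bounded. [cite: Tao2016AveragedNS, §1.1 pp. 6–8] -/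
theorem not_isAveragingInsensitive_continuesUnder (h : AveragedTypeIBlowup) {N : L2C → ℝ≥0∞}
    (hA : StepTest.IsAveragingInsensitive (StepTest.APrioriBound N)) :
    ¬ StepTest.IsAveragingInsensitive (StepTest.ContinuesUnder N) :=
  fun hC => abstractTwoStepFails h N fun 𝒜 hs hc =>
    ⟨hA 𝒜 hs hc, hC 𝒜 hs hc⟩

/-- **Structured reading of the entry:** for every `N` some symmetric cancelling datum violates
(A) or violates (C) (classical logic on `abstractTwoStepFails`). [cite: Tao2016AveragedNS, §1.1 Thm. 1.5 and p. 8] -/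
theorem exists_not_aprioriBound_or_not_continuesUnder (h : AveragedTypeIBlowup)
    (N : L2C → ℝ≥0∞) :
    ∃ 𝒜 : AveragingDatum, 𝒜.IsSymmetric ∧ 𝒜.HasCancellation ∧
      (¬ StepTest.APrioriBound N 𝒜 ∨ ¬ StepTest.ContinuesUnder N 𝒜) := by
  by_contra hcon
  push Not at hcon
  exact abstractTwoStepFails h N fun 𝒜 hs hc => hcon 𝒜 hs hc

/-- **What an averaging-insensitive pair would have proved for Navier–Stokes.** If for some `N`
both (A) and (C) were averaging-insensitive, then in particular `H¹⁰_df`-mild Navier–Stokes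
solutions from Schwartz data would never break down in finite time (`NoBreakdown euler`, the
no-blow-up half of Tao's Conj. 1.2) — recorded to show that the blocked template is a genuine
regularity strategy, not a straw man. [cite: Tao2016AveragedNS, §1.1 Conj. 1.2 and (1.13)] -/
theorem noBreakdown_euler_of_isAveragingInsensitive_pair {N : L2C → ℝ≥0∞}
    (h : StepTest.IsAveragingInsensitive fun 𝒜 =>
      StepTest.APrioriBound N 𝒜 ∧ StepTest.ContinuesUnder N 𝒜) :
    StepTest.NoBreakdown AveragingDatum.euler :=
  noBreakdown_of_aprioriBound_of_continuesUnder h.euler.1 h.euler.2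


/-! ## Euler instances of the two halves (the Navier–Stokes statements an averaging-insensitive proof would also prove) -/

/-- `APrioriBound N euler` spelled out: the a priori bound on `N` along every `H¹⁰_df`-mild solution of the
projected Navier–Stokes equation `∂ₜu = Δu + B(u,u)` (`ν = 1`, Tao (1.5)/(1.6)) from Schwartz divergence-free
data — the (A)-half of the template for the true equations. [cite: Tao2016AveragedNS, §1.1 (1.5) and (1.13)] -/
theorem StepTest.aprioriBound_euler_iff (N : L2C → ℝ≥0∞) :
    StepTest.APrioriBound N AveragingDatum.euler ↔
      ∀ u₀ : SchwartzMap (EuclideanSpace ℝ (Fin 3)) (EuclideanSpace ℝ (Fin 3)),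
        VectorCalculus.IsDivFree ⇑u₀ → ∀ T : ℝ, 0 < T → ∀ u : ℝ → L2C,
          IsMildSolutionFor eulerForm (schwartzL2 u₀) (Set.Ico 0 T) u →
            ∃ C : ℝ≥0, ∀ t ∈ Set.Ico 0 T, N (u t) ≤ C := by
  simp only [StepTest.APrioriBound, AveragedTypeI.isMildSolution_euler_iff]

/-- `ContinuesUnder N euler` spelled out: continuation past `T` of every `H¹⁰_df`-mild Navier–Stokes solution
on `[0,T)` from Schwartz divergence-free data along which `N` stays bounded — the (C)-half of the template for
the true equations (for `N = ‖·‖_{L³}`, `‖·‖_{Ḣ^{1/2}}`, critical Besov norms this is the shape of the genuine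
continuation theorems listed under `evasions_known`, there for Leray–Hopf / classical solutions).
[cite: EscauriazaSereginSverak2003, Thms. 1.3–1.4] -/
theorem StepTest.continuesUnder_euler_iff (N : L2C → ℝ≥0∞) :
    StepTest.ContinuesUnder N AveragingDatum.euler ↔
      ∀ u₀ : SchwartzMap (EuclideanSpace ℝ (Fin 3)) (EuclideanSpace ℝ (Fin 3)),
        VectorCalculus.IsDivFree ⇑u₀ → ∀ T : ℝ, 0 < T → ∀ u : ℝ → L2C,
          IsMildSolutionFor eulerForm (schwartzL2 u₀) (Set.Ico 0 T) u →
            (∃ C : ℝ≥0, ∀ t ∈ Set.Ico 0 T, N (u t) ≤ C) →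
              ∃ T' : ℝ, T < T' ∧ ∃ v : ℝ → L2C,
                IsMildSolutionFor eulerForm (schwartzL2 u₀) (Set.Ico 0 T') v ∧
                  ∀ t ∈ Set.Ico 0 T, v t = u t := by
  simp only [StepTest.ContinuesUnder, AveragedTypeI.HasMildExtension,
    AveragedTypeI.isMildSolution_euler_iff]

/-- **An averaging-insensitive (A)-half proves the Navier–Stokes a priori bound** (Euler instance):
[cite: Tao2016AveragedNS, §1.1 (1.2) and (1.13)] -/
theorem StepTest.aprioriBound_euler_of_isAveragingInsensitive {N : L2C → ℝ≥0∞}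
    (h : StepTest.IsAveragingInsensitive (StepTest.APrioriBound N)) :
    StepTest.APrioriBound N AveragingDatum.euler :=
  h.euler

/-- **An averaging-insensitive (C)-half proves the Navier–Stokes continuation criterion** (Euler instance).
[cite: Tao2016AveragedNS, §1.1 (1.2) and (1.13)] -/
theorem StepTest.continuesUnder_euler_of_isAveragingInsensitive {N : L2C → ℝ≥0∞}
    (h : StepTest.IsAveragingInsensitive (StepTest.ContinuesUnder N)) :
    StepTest.ContinuesUnder N AveragingDatum.euler :=
  h.euler

end Literature.Barriers.NavierStokesRegularity

end
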